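import Summits.QuantumAdvantage.QuantumAdvantage.Theorems.CharDialTokenDialN1
import Summits.QuantumAdvantage.QuantumAdvantage.Theorems.CharDialTokenDialD1
import HarnessLib

/-!
# WalkHardFJLinOdd — the token dial, part N2: joint (address, far-gap) classes of a multi-form cell

Cell `decomp-qadv`, lens 6, generation 19 (REV4 «FarFlipDial»).  Part N1's weighted count specialised to the junta cells of part D1
(`cellM O β A V`, presented to the Literature side by `lamM` / `vlM`, `forms_eq_iffM`):

* `rowA t` — the ADDRESS ROW (weight `2` left of `t`, `1` from `t` on) with `addr c u t ≡ c + t + Σ_{u_i} rowA t i (mod 3)`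
  (`addr_cast`, `addr_eq_iff_rowA`): no reflection is needed any more (part D1 reflected to reach the unweighted Literature lemma);
* `rowG a b` — the GAP ROW of a window `[a, b)` with `wseg u a b ≡ Σ_{u_i} rowG a b i (mod 3)` (`wseg_cast`);
* `rowsF t far` / `classF` — for a tuple `far : Fin m → Fin (n+1)` of far readers: the `m + 1` rows (address, then the gap rows of the
  windows between each far reader and `t`) and the class of a cell with prescribed address `rr` and gap residues `ρ`;
  `classR` — the class with prescribed gap residues only;
* `card_cellM_le_classW` — `#cell ≤ 3^J·#class + 3^J·2ⁿ·cos(π/(3p))^L` for any rows whose non-trivial combinations have ≥ `L` non-zero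
  coordinates (part N1 on `lamM`/`vlM`);
* ★ `classR_le_three_classF` — inside a gap-residue class the address is equidistributed:
  `#classR ρ ≤ 3·#classF ρ rr + 4·2ⁿ·cos(π/(3p))^L`, under the independence hypothesis
  `IndepRows t far L` («every non-trivial `ℤ/3`-combination of the address row and the gap rows has ≥ L non-zero coordinates»).
-/

set_option autoImplicit false

namespace Summit.QuantumAdvantage.AdviceFreeQNC0.JLinPeel.TokenDial

open Finset SegMove

variable {n : ℕ}

/-! ### §1 the address row and the gap rows -/

/-- the ADDRESS ROW of cut position `t`: weight `2` on coordinates `< t`, weight `1` on coordinates `≥ t`. -/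
def rowA (t : ℕ) : Fin n → ZMod 3 := fun i => if i.val < t then 2 else 1

/-- the GAP ROW of the window `[a, b)`: the indicator weights. -/
def rowG (a b : ℕ) : Fin n → ZMod 3 := fun i => if a ≤ i.val ∧ i.val < b then 1 else 0

/-- the walk exponent as a weighted coordinate sum (naturals). -/
theorem walkExp_eq_sum (u : Fin n → Bool) (t : ℕ) :
    walkExp u t = ∑ i : Fin n, if u i = true then (if i.val < t then 2 else 1) else 0 := by
  unfold walkExp wt wtPrefix
  rw [card_filter, card_filter, ← sum_add_distrib]
  refine sum_congr rfl fun i _ => ?_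
  by_cases h1 : u i = true <;> by_cases h2 : i.val < t <;> simp [h1, h2]

/-- **the address is affine in the address row:** `addr c u t ≡ c + t + Σ_{u_i} rowA t i (mod 3)`. -/
theorem addr_cast (c : ℕ) (u : Fin n → Bool) (t : ℕ) :
    ((addr c u t : ℕ) : ZMod 3) = (c : ZMod 3) + (t : ZMod 3) + ∑ i : Fin n, if u i = true then rowA t i else 0 := by
  rw [addr_eq, ZMod.natCast_mod, walkExp_eq_sum u t]
  simp only [Nat.cast_add, Nat.cast_sum, Nat.cast_ite, Nat.cast_ofNat, Nat.cast_one, Nat.cast_zero, rowA]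

/-- an address class is a class of the address row. -/
theorem addr_eq_iff_rowA (c : ℕ) (u : Fin n → Bool) (t : ℕ) (rr : ℕ) (hrr : rr < 3) :
    addr c u t = rr ↔ (∑ i : Fin n, if u i = true then rowA t i else 0) = (rr : ZMod 3) - (c : ZMod 3) - (t : ZMod 3) := by
  have hlt : addr c u t < 3 := by rw [addr_eq]; exact Nat.mod_lt _ (by norm_num)
  constructor
  · intro h
    have := addr_cast c u t
    rw [h] at this
    rw [this]
    ring
  · intro h
    have hc := addr_cast c u t
    rw [h] at hc
    have h2 : ((addr c u t : ℕ) : ZMod 3) = (rr : ZMod 3) := by rw [hc]; ring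
    rw [ZMod.natCast_eq_natCast_iff', Nat.mod_eq_of_lt hlt, Nat.mod_eq_of_lt hrr] at h2
    exact h2

/-- **a window count is the gap-row sum:** `wseg u a b ≡ Σ_{u_i} rowG a b i (mod 3)`. -/
theorem wseg_cast (u : Fin n → Bool) (a b : ℕ) :
    ((wseg u a b : ℕ) : ZMod 3) = ∑ i : Fin n, if u i = true then rowG a b i else 0 := by
  unfold wseg rowG
  rw [card_filter]
  push_cast
  refine sum_congr rfl fun i _ => ?_
  by_cases h1 : u i = true <;> by_cases h2 : (a ≤ i.val ∧ i.val < b) <;> simp [h1, h2]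

/-! ### §2 classes of a multi-form cell by rows -/

section Classes

variable {p : ℕ} [hp : Fact p.Prime]

/-- the class of a multi-form cell on which the `J` row sums take the values `σ`. -/
def classW {J : ℕ} (O : Finset (Fin n)) (β : Fin n → Bool) (A : Fin (n + 1) → Fin n → ZMod p) (V : Fin (n + 1) → ZMod p)
    (W : Fin J → Fin n → ZMod 3) (σ : Fin J → ZMod 3) : Finset (Fin n → Bool) :=
  (cellM O β A V).filter fun u => (fun j => ∑ i : Fin n, if u i = true then W j i else 0) = σ

/-- **part N1 on junta cells:** `#cell ≤ 3^J·#classW + 3^J·2ⁿ·cos(π/(3p))^L` whenever every non-trivial combination of the rows has at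
least `L` non-zero coordinates. -/
theorem card_cellM_le_classW (hp3 : p ≠ 3) {J : ℕ} (O : Finset (Fin n)) (β : Fin n → Bool)
    (A : Fin (n + 1) → Fin n → ZMod p) (V : Fin (n + 1) → ZMod p) (W : Fin J → Fin n → ZMod 3) (σ : Fin J → ZMod 3) (L : ℕ)
    (hL : ∀ μ : Fin J → ZMod 3, μ ≠ 0 → L ≤ (univ.filter fun i => ¬ combW μ W i = 0).card) :
    ((cellM O β A V).card : ℝ) ≤ (3 : ℝ) ^ J * ((classW O β A V W σ).card : ℝ)
      + (3 : ℝ) ^ J * (2 : ℝ) ^ n * Real.cos (Real.pi / (3 * p)) ^ L := by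
  classical
  haveI : NeZero p := ⟨hp.out.ne_zero⟩
  have hcop : p.Coprime 3 := (Nat.coprime_primes hp.out Nat.prime_three).mpr hp3
  have h := card_cell_le_pow_mul_card_classW (ι := Fin n) hcop (lamM O A) (vlM O β V) W σ L hL
  have e1 : (univ.filter fun u : Fin n → Bool =>
        (fun j => ∑ i : Fin n, if u i = true then W j i else 0) = σ ∧
          (fun j => ∑ i, if u i then lamM O A j i else 0) = vlM O β V)
      = classW O β A V W σ := by
    unfold classW cellM
    rw [filter_filter]
    refine filter_congr fun w _ => ?_
    rw [forms_eq_iffM]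
    tauto
  have e2 : (univ.filter fun u : Fin n → Bool => (fun j => ∑ i, if u i then lamM O A j i else 0) = vlM O β V)
      = cellM O β A V := by
    unfold cellM
    exact filter_congr fun w _ => forms_eq_iffM O β A V w
  rw [e1, e2, Fintype.card_fin] at h
  exact h

variable {m : ℕ}

/-- the rows of the far engine: the address row of `t`, then the gap row of the window between each far reader and `t`. -/
def rowsF (t : Fin n) (far : Fin m → Fin (n + 1)) : Fin (m + 1) → Fin n → ZMod 3 :=
  Fin.cases (rowA t.val) fun k => rowG (min (far k).val t.val) (max (far k).val t.val)

/-- the prescribed values: address residue `rr` (shifted by `c + t`), then the gap residues `ρ`. -/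
def valsF (c : ℕ) (t : Fin n) (rr : ℕ) (ρ : Fin m → ZMod 3) : Fin (m + 1) → ZMod 3 :=
  Fin.cases ((rr : ZMod 3) - (c : ZMod 3) - (t.val : ZMod 3)) ρ

/-- **INDEPENDENCE of the rows at level `L`:** every non-trivial `ℤ/3`-combination of the address row and the gap rows has at least `L`
non-zero coordinates (implied by: every window between consecutive marks has ≥ `L` coordinates and ≥ `L` coordinates lie outside the hull
of the marks — part P proves the one-far-reader case). -/
def IndepRows (t : Fin n) (far : Fin m → Fin (n + 1)) (L : ℕ) : Prop :=
  ∀ μ : Fin (m + 1) → ZMod 3, μ ≠ 0 → L ≤ (univ.filter fun i : Fin n => ¬ combW μ (rowsF t far) i = 0).card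

/-- the GAP-RESIDUE class of a cell: the windows between the far readers and `t` have prescribed counts mod `3`. -/
def classR (O : Finset (Fin n)) (β : Fin n → Bool) (A : Fin (n + 1) → Fin n → ZMod p) (V : Fin (n + 1) → ZMod p)
    (t : Fin n) (far : Fin m → Fin (n + 1)) (ρ : Fin m → ZMod 3) : Finset (Fin n → Bool) :=
  (cellM O β A V).filter fun u => ∀ k, ((wseg u (min (far k).val t.val) (max (far k).val t.val) : ℕ) : ZMod 3) = ρ k

/-- the (ADDRESS, GAP-RESIDUE) class of a cell. -/
def classF (c : ℕ) (O : Finset (Fin n)) (β : Fin n → Bool) (A : Fin (n + 1) → Fin n → ZMod p) (V : Fin (n + 1) → ZMod p)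
    (t : Fin n) (far : Fin m → Fin (n + 1)) (ρ : Fin m → ZMod 3) (rr : ℕ) : Finset (Fin n → Bool) :=
  (cellM O β A V).filter fun u => addr c u t.val = rr ∧
    ∀ k, ((wseg u (min (far k).val t.val) (max (far k).val t.val) : ℕ) : ZMod 3) = ρ k

omit hp in
/-- the (address, gap-residue) class is the row class of `rowsF` with values `valsF`. -/
theorem classF_eq_classW (c : ℕ) (O : Finset (Fin n)) (β : Fin n → Bool) (A : Fin (n + 1) → Fin n → ZMod p)
    (V : Fin (n + 1) → ZMod p) (t : Fin n) (far : Fin m → Fin (n + 1)) (ρ : Fin m → ZMod 3) (rr : ℕ) (hrr : rr < 3) :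
    classF c O β A V t far ρ rr = classW O β A V (rowsF t far) (valsF c t rr ρ) := by
  unfold classF classW
  refine filter_congr fun u _ => ?_
  rw [addr_eq_iff_rowA c u t.val rr hrr, funext_iff, Fin.forall_fin_succ]
  unfold rowsF valsF
  simp only [Fin.cases_zero, Fin.cases_succ, wseg_cast]

omit hp in
/-- the gap-residue class is the row class of the gap rows alone. -/
theorem classR_eq_classW (O : Finset (Fin n)) (β : Fin n → Bool) (A : Fin (n + 1) → Fin n → ZMod p)
    (V : Fin (n + 1) → ZMod p) (t : Fin n) (far : Fin m → Fin (n + 1)) (ρ : Fin m → ZMod 3) :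
    classR O β A V t far ρ =
      classW O β A V (fun k => rowG (min (far k).val t.val) (max (far k).val t.val)) ρ := by
  unfold classR classW
  refine filter_congr fun u _ => ?_
  rw [funext_iff]
  simp only [wseg_cast]

omit hp in
/-- the classes `classF ρ rr`, `rr < 3`, partition `classR ρ`. -/
theorem card_classR_eq_sum (c : ℕ) (O : Finset (Fin n)) (β : Fin n → Bool) (A : Fin (n + 1) → Fin n → ZMod p)
    (V : Fin (n + 1) → ZMod p) (t : Fin n) (far : Fin m → Fin (n + 1)) (ρ : Fin m → ZMod 3) :
    (classR O β A V t far ρ).card = ∑ rr ∈ range 3, (classF c O β A V t far ρ rr).card := by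
  unfold classR classF
  have h := (card_eq_sum_card_fiberwise (s := (cellM O β A V).filter fun u =>
      ∀ k, ((wseg u (min (far k).val t.val) (max (far k).val t.val) : ℕ) : ZMod 3) = ρ k) (t := range 3)
    (f := fun u => addr c u t.val) fun u _ => by
      simp only [coe_range, Set.mem_Iio, addr_eq]; exact Nat.mod_lt _ (by norm_num))
  rw [h]
  refine sum_congr rfl fun rr _ => ?_
  rw [filter_filter]
  congr 1
  ext u
  simp only [mem_filter]
  tauto

/-- independence of all rows gives independence of the gap rows alone (prepend `μ₀ = 0`). -/
theorem indep_gapRows (t : Fin n) (far : Fin m → Fin (n + 1)) (L : ℕ) (hI : IndepRows t far L)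
    (μ : Fin m → ZMod 3) (hμ : μ ≠ 0) :
    L ≤ (univ.filter fun i : Fin n =>
      ¬ combW μ (fun k => rowG (min (far k).val t.val) (max (far k).val t.val)) i = 0).card := by
  have h := hI (Fin.cases 0 μ) (by
    intro h0
    apply hμ
    funext k
    have := congrFun h0 k.succ
    simpa using this)
  refine h.trans (le_of_eq ?_)
  congr 1
  refine filter_congr fun i _ => ?_
  unfold combW rowsF
  rw [Fin.sum_univ_succ]
  simp only [Fin.cases_zero, Fin.cases_succ, zero_mul, zero_add]

/-- ★ **inside a gap-residue class the address is equidistributed:** `#classR ρ ≤ 3·#classF ρ rr + 4·2ⁿ·cos(π/(3p))^L`. -/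
theorem classR_le_three_classF (hp3 : p ≠ 3) (c : ℕ) (O : Finset (Fin n)) (β : Fin n → Bool)
    (A : Fin (n + 1) → Fin n → ZMod p) (V : Fin (n + 1) → ZMod p) (t : Fin n) (far : Fin m → Fin (n + 1))
    (ρ : Fin m → ZMod 3) (rr : ℕ) (hrr : rr < 3) (L : ℕ) (hI : IndepRows t far L) :
    ((classR O β A V t far ρ).card : ℝ) ≤ 3 * ((classF c O β A V t far ρ rr).card : ℝ)
      + 4 * (2 : ℝ) ^ n * Real.cos (Real.pi / (3 * p)) ^ L := by
  classical
  haveI : NeZero p := ⟨hp.out.ne_zero⟩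
  have hcop : p.Coprime 3 := (Nat.coprime_primes hp.out Nat.prime_three).mpr hp3
  -- two-sided count of the full class and of the gap class
  have hfull := abs_pow_mul_card_classW_sub_card_le (ι := Fin n) hcop (lamM O A) (vlM O β V) (rowsF t far)
    (valsF c t rr ρ) L hI
  have hgap := abs_pow_mul_card_classW_sub_card_le (ι := Fin n) hcop (lamM O A) (vlM O β V)
    (fun k => rowG (min (far k).val t.val) (max (far k).val t.val)) ρ L (indep_gapRows t far L hI)
  have eW : ∀ {J : ℕ} (W : Fin J → Fin n → ZMod 3) (σ : Fin J → ZMod 3), (univ.filter fun u : Fin n → Bool =>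
        (fun j => ∑ i : Fin n, if u i = true then W j i else 0) = σ ∧
          (fun j => ∑ i, if u i then lamM O A j i else 0) = vlM O β V) = classW O β A V W σ := by
    intro J W σ
    unfold classW cellM
    rw [filter_filter]
    refine filter_congr fun w _ => ?_
    rw [forms_eq_iffM]
    tauto
  have e2 : (univ.filter fun u : Fin n → Bool => (fun j => ∑ i, if u i then lamM O A j i else 0) = vlM O β V)
      = cellM O β A V := by
    unfold cellM
    exact filter_congr fun w _ => forms_eq_iffM O β A V w
  rw [eW, e2, Fintype.card_fin, ← classF_eq_classW c O β A V t far ρ rr hrr] at hfull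
  rw [eW, e2, Fintype.card_fin, ← classR_eq_classW O β A V t far ρ] at hgap
  have h1 := (abs_le.mp hfull).1
  have h2 := (abs_le.mp hgap).2
  have h3pos : (0 : ℝ) < (3 : ℝ) ^ m := by positivity
  have hE : 0 ≤ (2 : ℝ) ^ n * Real.cos (Real.pi / (3 * p)) ^ L := by
    have h0 : 0 ≤ Real.cos (Real.pi / (3 * p)) := by linarith [one_le_two_mul_cos p]
    positivity
  -- divide by 3^m
  rw [pow_succ] at h1
  have key : (3 : ℝ) ^ m * ((classR O β A V t far ρ).card : ℝ)
      ≤ (3 : ℝ) ^ m * (3 * ((classF c O β A V t far ρ rr).card : ℝ)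
        + 4 * (2 : ℝ) ^ n * Real.cos (Real.pi / (3 * p)) ^ L) := by
    have e : (3 : ℝ) ^ m * (3 * ((classF c O β A V t far ρ rr).card : ℝ)
        + 4 * (2 : ℝ) ^ n * Real.cos (Real.pi / (3 * p)) ^ L)
        = (3 : ℝ) ^ m * 3 * ((classF c O β A V t far ρ rr).card : ℝ)
          + 4 * ((3 : ℝ) ^ m * (2 : ℝ) ^ n * Real.cos (Real.pi / (3 * p)) ^ L) := by ring
    have e2 : (3 : ℝ) ^ m * 3 * (2 : ℝ) ^ n * Real.cos (Real.pi / (3 * p)) ^ L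
        = 3 * ((3 : ℝ) ^ m * (2 : ℝ) ^ n * Real.cos (Real.pi / (3 * p)) ^ L) := by ring
    rw [e]
    rw [e2] at h1
    have h2' : (3 : ℝ) ^ m * ((classR O β A V t far ρ).card : ℝ) ≤ ((cellM O β A V).card : ℝ)
        + (3 : ℝ) ^ m * (2 : ℝ) ^ n * Real.cos (Real.pi / (3 * p)) ^ L := by linarith
    linarith
  exact le_of_mul_le_mul_left key h3pos

end Classes

end Summit.QuantumAdvantage.AdviceFreeQNC0.JLinPeel.TokenDial
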